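import Literature.AlgebraicGeometry.AbelianSchemes.AbelianSchemeEndomorphismComplexDescent
import Literature.AlgebraicGeometry.AbelianSchemes.AbelianSchemeFibreHom
import Literature.AlgebraicGeometry.AbelianSchemes.AbelianSchemePolarization
import HarnessLib

/-!
# Descent from `ℂ` to `K` of a Galois-equivariant FAMILY of endomorphisms, together with its fibrewise READINGS

Layer `Literature/AlgebraicGeometry/AbelianSchemes`, namespace `Literature.AlgebraicGeometry.AbelianSchemes.AbelianSchemeOver`.
THEOREMS ONLY, sequel of ★ (B-γ) `AbelianSchemeEndomorphismComplexDescent`.  Cell `hodgecm-mathlib` (D-0151), FLOOR 0, P6 «MOD», crux hLiu418 =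
stmt-HodgeConjecture-24832 (`--supports`): layer D2 of the E6 closer of the E-line `Cruxes/HLiu418/Lines/F0_P6a_PELWitnessE.lean` (A-p06 (g32),
`E6Closer.skeleton.v4` `exists_reads_of_readsC`), stated GENERICALLY.

THE STATEMENT ([Milne2005ShimuraVarieties] Prop. 13.1 + Rem. 13.8 on the total space; [MumfordFogartyKirwan1994] Ch. 6 §1 Cor. 6.2).  `K ⊆ ℂ`
countable, `T` a separated locally Noetherian `K`-scheme with `T_ℂ` locally Noetherian, `A → T` an abelian scheme with `A ×_T T_ℂ` reduced, and
`Y : O → End_{T_ℂ}(A ×_T T_ℂ)` ANY family of homomorphisms commuting with the canonical Galois automorphisms `1 ×_T gal σ` (`σ ∈ Aut(ℂ∕K)`).  Then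
(§1) `Y b = e b ×_T T_ℂ` for a family `e : O → End_T(A)` of homomorphisms (★ B-γ, member by member); and (§2) READINGS DESCEND: if at a complex point
`x ∈ T(ℂ)` (section `x̃ ∈ T_ℂ(ℂ)`) `Y b` moves the `ℂ`-point of the total space over a fibre point `P ∈ A_x(ℂ)` to the point over `Q`, then the fibre
homomorphism `(e b)_x` maps `P` to `Q` (`(Y b) ≫ pr₁ = pr₁ ≫ e b`, ★ `fibrePointToLeft_map_fibreHom`, `fibrePointToLeft_injective`) — the relation
form in which the analytic organ of E6 delivers the marking readings `(Y b)(φ t) = φ(M b · t)` over `ℂ`, returned as readings of `e b` over `K`.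
HC_CM is proved only modulo the printed citations until rung 0 closes; this file asserts nothing about HC.  Presearch: [Milne2005ShimuraVarieties,
§13 Prop. 13.1 p. 117, Thm. 13.7∕Rem. 13.8 p. 119] (held, ★ B-γ); tree `rg 'fibrePointToLeft' AbelianSchemeEndomorphismComplexDescent` = ∅.

## References
* [Milne2005ShimuraVarieties] J. S. Milne, *Introduction to Shimura Varieties* (2005), §13 Prop. 13.1 (p. 117), Thm. 13.7 and Rem. 13.8 (p. 119).
* [MumfordFogartyKirwan1994] D. Mumford, J. Fogarty, F. Kirwan, *Geometric Invariant Theory*, 3rd ed. (1994), Ch. 6 §1 Cor. 6.2 (p. 116),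
  §2 Definition 6.3 (p. 120).
* [GortzWedhorn2020] U. Görtz, T. Wedhorn, *Algebraic Geometry I*, 2nd ed. (2020), Section (4.7), §(14.20).
-/

set_option autoImplicit false

noncomputable section

open CategoryTheory CategoryTheory.Limits AlgebraicGeometry Cardinal
open scoped MonObj
open Literature.AlgebraicGeometry.Motives (SchemeOver AlgPoints)
open Literature.AlgebraicGeometry.Motives.GaloisDescent (gal bc gal_fst)
open Literature.AlgebraicGeometry.Motives.AbelianVariety (bcSpec)

namespace Literature.AlgebraicGeometry.AbelianSchemes

namespace AbelianSchemeOver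

variable {K : Type} [Field K] [Algebra K ℂ] {T : SchemeOver K} (A : AbelianSchemeOver T.left)

/-! ## §1 Descent of an equivariant FAMILY (★ B-γ member by member) -/

/-- **An `O`-indexed family of endomorphisms of `A_ℂ ∕ T_ℂ` commuting with the canonical Galois automorphisms `1 ×_T gal σ` descends to `T`**:
`Y b = e b ×_T T_ℂ` with every `e b` a homomorphism (★ `existsUnique_pullback_map_eq_of_forall_gal_comp` for the canonical `galA`, ★
`pullbackMap_gal_fst_snd`, ★ `isMonHom_of_pullback_map_eq_bcSpec`).
[cite: Milne2005ShimuraVarieties, §13 Prop. 13.1 p. 117 and Thm. 13.7 / Rem. 13.8 p. 119] -/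
theorem exists_family_pullback_map_eq_of_forall_gal_comp (hK : #K ≤ ℵ₀) [IsSeparated T.hom] [IsLocallyNoetherian T.left]
    [IsLocallyNoetherian (bc ℂ T)] [IsReduced (pullback A.X.hom (pullback.fst T.hom (bcSpec K ℂ)))]
    {O : Type*} (Y : O → ((A.baseChange (pullback.fst T.hom (bcSpec K ℂ))).X ⟶ (A.baseChange (pullback.fst T.hom (bcSpec K ℂ))).X))
    [hY : ∀ b, IsMonHom (Y b)]
    (hgal : ∀ (b : O) (σ : ℂ ≃ₐ[K] ℂ),
      pullback.map A.X.hom (pullback.fst T.hom (bcSpec K ℂ)) A.X.hom (pullback.fst T.hom (bcSpec K ℂ)) (𝟙 A.X.left)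
          (gal ℂ T σ) (𝟙 T.left) (by rw [Category.comp_id, Category.id_comp]) (by rw [Category.comp_id, gal_fst]) ≫ (Y b).left =
        (Y b).left ≫ pullback.map A.X.hom (pullback.fst T.hom (bcSpec K ℂ)) A.X.hom (pullback.fst T.hom (bcSpec K ℂ)) (𝟙 A.X.left)
          (gal ℂ T σ) (𝟙 T.left) (by rw [Category.comp_id, Category.id_comp]) (by rw [Category.comp_id, gal_fst])) :
    ∃ e : O → (A.X ⟶ A.X), (∀ b, IsMonHom (e b)) ∧ ∀ b, (Over.pullback (pullback.fst T.hom (bcSpec K ℂ))).map (e b) = Y b := by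
  have h : ∀ b, ∃ e : A.X ⟶ A.X, IsMonHom e ∧ (Over.pullback (pullback.fst T.hom (bcSpec K ℂ))).map e = Y b := fun b => by
    obtain ⟨e, he, -⟩ := A.existsUnique_pullback_map_eq_of_forall_gal_comp _ (fun σ => (A.pullbackMap_gal_fst_snd σ).1)
      (fun σ => (A.pullbackMap_gal_fst_snd σ).2) (Y b) hK (hgal b)
    exact ⟨e, A.isMonHom_of_pullback_map_eq_bcSpec (Y b) e he, he⟩
  choose e he using h
  exact ⟨e, fun b => (he b).1, fun b => (he b).2⟩

/-! ## §2 Readings descend along `pr₁ : A ×_T T_ℂ → A` -/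

/-- **The fibre homomorphism of the descended endomorphism is read off the total space over `ℂ`.**  Let `e : A → A` be a homomorphism over `T`
with base change `r = e ×_T T_ℂ`, `x ∈ T(ℂ)` a complex point (along `K ⊆ ℂ`), and `P, Q ∈ A_x(ℂ)` points of the fibre.  If every `ℂ`-point `q` of
`A ×_T T_ℂ` lying over the point of `P` (`q ≫ pr₁ = P̲`) and over the SECTION of `x` (`q ≫ pr₂ ≫ pr₂ = 𝟙`) satisfies `q ≫ r ≫ pr₁ = Q̲`, then
`e_x(P) = Q` (`r ≫ pr₁ = pr₁ ≫ e`; ★ `fibrePointToLeft_map_fibreHom`; ★ `fibrePointToLeft_injective`).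
[cite: MumfordFogartyKirwan1994, Ch. 6 §2 Definition 6.3 (p. 120)] [cite: GortzWedhorn2020, Section (4.7)] -/
theorem algPointsMap_fibreHom_eq_of_forall_lift (e : A.X ⟶ A.X) [IsMonHom e]
    (r : (A.baseChange (pullback.fst T.hom (bcSpec K ℂ))).X ⟶ (A.baseChange (pullback.fst T.hom (bcSpec K ℂ))).X)
    (hr : (Over.pullback (pullback.fst T.hom (bcSpec K ℂ))).map e = r)
    (x : AlgPoints T ℂ) (P Q : (A.fibre x.left).toAbelianVariety.Points ℂ)
    (h : ∀ q : Spec (.of ℂ) ⟶ pullback A.X.hom (pullback.fst T.hom (bcSpec K ℂ)),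
      q ≫ pullback.fst A.X.hom (pullback.fst T.hom (bcSpec K ℂ)) = A.fibrePointToLeft x.left P →
      q ≫ pullback.snd A.X.hom (pullback.fst T.hom (bcSpec K ℂ)) ≫ pullback.snd T.hom (bcSpec K ℂ) = 𝟙 _ →
      (q ≫ r.left) ≫ pullback.fst A.X.hom (pullback.fst T.hom (bcSpec K ℂ)) = A.fibrePointToLeft x.left Q) :
    AlgPoints.map (fibreHom e x.left).hom.hom.hom P = Q := by
  -- the section `x̃` of `x` in `T_ℂ` and the lift `q` of the point of `P`
  have hx : x.left ≫ T.hom = 𝟙 _ ≫ bcSpec K ℂ := by rw [Category.id_comp]; exact Over.w x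
  let xt : Spec (.of ℂ) ⟶ bc ℂ T := pullback.lift x.left (𝟙 _) hx
  have hP : A.fibrePointToLeft x.left P ≫ A.X.hom = xt ≫ pullback.fst T.hom (bcSpec K ℂ) := by
    rw [fibrePointToLeft_comp_hom, pullback.lift_fst]
  let q : Spec (.of ℂ) ⟶ pullback A.X.hom (pullback.fst T.hom (bcSpec K ℂ)) := pullback.lift (A.fibrePointToLeft x.left P) xt hP
  have hq := h q (pullback.lift_fst _ _ _) (by rw [pullback.lift_snd_assoc, pullback.lift_snd])
  -- `r ≫ pr₁ = pr₁ ≫ e`, evaluated at `q`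
  have h1 : r.left ≫ pullback.fst A.X.hom (pullback.fst T.hom (bcSpec K ℂ)) =
      pullback.fst A.X.hom (pullback.fst T.hom (bcSpec K ℂ)) ≫ e.left := by
    rw [← hr]
    exact pullback_map_left_comp_fst' _ _
  have hq' : (q ≫ r.left) ≫ pullback.fst A.X.hom (pullback.fst T.hom (bcSpec K ℂ)) =
      A.fibrePointToLeft x.left P ≫ e.left :=
    calc (q ≫ r.left) ≫ pullback.fst A.X.hom (pullback.fst T.hom (bcSpec K ℂ))
        = q ≫ (r.left ≫ pullback.fst A.X.hom (pullback.fst T.hom (bcSpec K ℂ))) := Category.assoc _ _ _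
      _ = q ≫ (pullback.fst A.X.hom (pullback.fst T.hom (bcSpec K ℂ)) ≫ e.left) := congrArg (fun k => q ≫ k) h1
      _ = (q ≫ pullback.fst A.X.hom (pullback.fst T.hom (bcSpec K ℂ))) ≫ e.left := (Category.assoc _ _ _).symm
      _ = A.fibrePointToLeft x.left P ≫ e.left := by rw [pullback.lift_fst]
  have hPQ : A.fibrePointToLeft x.left P ≫ e.left = A.fibrePointToLeft x.left Q := hq'.symm.trans hq
  rw [← fibrePointToLeft_map_fibreHom] at hPQ
  exact A.fibrePointToLeft_injective x.left hPQ

end AbelianSchemeOver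

end Literature.AlgebraicGeometry.AbelianSchemes

end
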